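import Summits.HubbardSuperconductivity.HubbardSuperconductivity.Theorems.TwSeededEnsembleEquivalence.Negative.SeedTransfer
import Summits.HubbardSuperconductivity.HubbardSuperconductivity.Theorems.TwSeededEnsembleEquivalence.Negative.BetaMonotonicity
import Literature.MathematicalPhysics.QuantumLattice.HubbardGrandCanonicalDensity
import Literature.MathematicalPhysics.QuantumLattice.FermionLiebRobinson

/-!
# Coupling transfer (Template F) for crux `TwSeededEnsembleEquivalence` (stmt-HubbardSuperconductivity-1698)

Negative-side support lemmas (refuter, cdisprove gen 4), all sorry-free and definition-free. Companion of
`SeedTransfer.lean` (Template E, transfer in the seed `g`): here the transfer is in the REPULSION `U`.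
With `W = Σ_x n_{x↑} n_{x↓}` (`0 ≤ W`, `‖W‖ ≤ L²`) and `Hcan(U, g) = hubbardTorus 2 L 1 U − (g/L²)ΔᴴΔ`,
`Hgc(U, μ, g) = Hcan − μN̂`:

* `re_rayleigh_seededCan_mono_U` / `re_rayleigh_seededCan_le_add_U`: Rayleigh quotients of `Hcan` are
  non-decreasing in `U` and move by at most `(U' − U)L²` on unit vectors;
* `minEnergyOn_seededCan_mono_U` / `minEnergyOn_seededCan_le_add_U`: the same for every sector energy (`K ≠ ⊥`);
* `groundEnergy_seededGC_mono_U` / `groundEnergy_seededGC_le_add_U`: the same for the grand-canonical ground energy;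
* `hullGap_coupling_transfer` / `hullGap_coupling_transfer'`: the T = 0 hull gap of Template C,
  `Gap_L(U) := minE(Hcan(U,g), K) − ν − E₀(Hgc(U,μ,g))`, is `L²`-Lipschitz in `U`:
  `|Gap_L(U') − Gap_L(U)| ≤ (U' − U)L²` for `U ≤ U'`.

Reading (see `Cruxes/TwSeededEnsembleEquivalence/Disproof.lean`, gen 4): relative to the `U = 0` seeded model —
the reduced d-wave BCS model, solvable by the approximating-Hamiltonian method, whose T = 0 grand-canonical density
has no jump at any seed strength (strict convexity of the Bogoliubov functional in `s = |Δ|²`) — a kill of the crux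
at repulsion `U` has margin at most `U` per site; together with Template E (`≤ 32 g` over the pure model) this boxes
every possible counterexample into the `O(U) ∩ O(g)` correlation window at `T = 0`.
-/

namespace Summit.HubbardSuperconductivity.HubbardSuperconductivity.Theorems.TwSeededEnsembleEquivalence.Negative

open Matrix Literature.MathematicalPhysics.QuantumLattice
open Summit.HubbardSuperconductivity.HubbardSuperconductivity.Theses.ThermalWedge
open scoped ComplexOrder Matrix.Norms.L2Operator

noncomputable section

/-- Switching on more repulsion: `Hcan(U', g) − Hcan(U, g) = (U' − U) Σ_x n_{x↑} n_{x↓}`. [folklore] -/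
theorem seededCan_sub_seededCan_U (L : ℕ) [NeZero L] (U U' g : ℝ) :
    (hubbardTorus 2 L 1 U' - ((g / (L : ℝ) ^ 2 : ℝ) : ℂ) •
        ((pairField dWaveFormFactor L)ᴴ * pairField dWaveFormFactor L)) -
      (hubbardTorus 2 L 1 U - ((g / (L : ℝ) ^ 2 : ℝ) : ℂ) •
        ((pairField dWaveFormFactor L)ᴴ * pairField dWaveFormFactor L)) =
      ((U' - U : ℝ) : ℂ) • ∑ x : FermionTorus 2 L, numberOp x 0 * numberOp x 1 := by
  have h := hamiltonianWith_sub_hamiltonianWith (fermionTorusGraph 2 L) 1 U U' 0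
  change hubbardTorusWith 2 L 1 U' 0 - hubbardTorusWith 2 L 1 U 0 = _ at h
  rw [hubbardTorusWith_zero, hubbardTorusWith_zero] at h
  rw [sub_sub_sub_cancel_right, h]

/-- The same for the grand-canonical seeded Hamiltonians. [folklore] -/
theorem seededGC_sub_seededGC_U (L : ℕ) [NeZero L] (U U' μ g : ℝ) :
    (hubbardTorusWith 2 L 1 U' μ - ((g / (L : ℝ) ^ 2 : ℝ) : ℂ) •
        ((pairField dWaveFormFactor L)ᴴ * pairField dWaveFormFactor L)) -
      (hubbardTorusWith 2 L 1 U μ - ((g / (L : ℝ) ^ 2 : ℝ) : ℂ) •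
        ((pairField dWaveFormFactor L)ᴴ * pairField dWaveFormFactor L)) =
      ((U' - U : ℝ) : ℂ) • ∑ x : FermionTorus 2 L, numberOp x 0 * numberOp x 1 := by
  have h := hamiltonianWith_sub_hamiltonianWith (fermionTorusGraph 2 L) 1 U U' μ
  change hubbardTorusWith 2 L 1 U' μ - hubbardTorusWith 2 L 1 U μ = _ at h
  rw [sub_sub_sub_cancel_right, h]

/-- `‖Σ_x n_{x↑} n_{x↓}‖ ≤ L²` on the torus of side `L`. [folklore] -/
theorem norm_interaction_le (L : ℕ) [NeZero L] :
    ‖(∑ x : FermionTorus 2 L, numberOp x 0 * numberOp x 1 :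
      Matrix (Finset (Orb (FermionTorus 2 L))) (Finset (Orb (FermionTorus 2 L))) ℂ)‖ ≤ (L : ℝ) ^ 2 := by
  calc ‖∑ x : FermionTorus 2 L,
        (numberOp x 0 * numberOp x 1 : Matrix (Finset (Orb (FermionTorus 2 L))) (Finset (Orb (FermionTorus 2 L))) ℂ)‖
      ≤ ∑ x : FermionTorus 2 L,
        ‖(numberOp x 0 * numberOp x 1 : Matrix (Finset (Orb (FermionTorus 2 L))) (Finset (Orb (FermionTorus 2 L))) ℂ)‖ :=
        norm_sum_le _ _
    _ ≤ ∑ _x : FermionTorus 2 L, (1 : ℝ) := Finset.sum_le_sum fun x _ =>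
        (norm_mul_le _ _).trans (mul_le_one₀ (norm_numberOp_le_one x 0) (norm_nonneg _) (norm_numberOp_le_one x 1))
    _ = (L : ℝ) ^ 2 := by
        rw [Finset.sum_const, Finset.card_univ, card_fermionTorus, nsmul_eq_mul, mul_one]; push_cast; ring

/-- `0 ≤ Re⟨ψ, W ψ⟩ ≤ L²` for a unit vector (`W = Σ_x n_{x↑} n_{x↓} ≥ 0`, `‖W‖ ≤ L²`). [folklore] -/
theorem re_rayleigh_interaction_mem_Icc (L : ℕ) [NeZero L] {ψ : Fock (Orb (FermionTorus 2 L))}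
    (hψ : star ψ ⬝ᵥ ψ = 1) :
    (star ψ ⬝ᵥ (∑ x : FermionTorus 2 L, numberOp x 0 * numberOp x 1) *ᵥ ψ).re ∈ Set.Icc (0 : ℝ) ((L : ℝ) ^ 2) := by
  constructor
  · have h := (posSemidef_sum_numberOp_mul_numberOp (Λ := FermionTorus 2 L)).re_dotProduct_nonneg ψ
    simpa using h
  · exact (re_star_dotProduct_mulVec_le_opNorm _ hψ).trans (norm_interaction_le L)

/-! ### Rayleigh quotients and sector energies -/

/-- **Rayleigh quotients of the seeded canonical Hamiltonian are non-decreasing in `U`** (any vector). -/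
theorem re_rayleigh_seededCan_mono_U (L : ℕ) [NeZero L] {U U' : ℝ} (hU : U ≤ U') (g : ℝ)
    (ψ : Fock (Orb (FermionTorus 2 L))) :
    (star ψ ⬝ᵥ (hubbardTorus 2 L 1 U - ((g / (L : ℝ) ^ 2 : ℝ) : ℂ) •
        ((pairField dWaveFormFactor L)ᴴ * pairField dWaveFormFactor L)) *ᵥ ψ).re ≤
      (star ψ ⬝ᵥ (hubbardTorus 2 L 1 U' - ((g / (L : ℝ) ^ 2 : ℝ) : ℂ) •
        ((pairField dWaveFormFactor L)ᴴ * pairField dWaveFormFactor L)) *ᵥ ψ).re := by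
  have hdecomp := seededCan_sub_seededCan_U L U U' g
  rw [sub_eq_iff_eq_add] at hdecomp
  rw [hdecomp, add_mulVec, dotProduct_add, Complex.add_re, smul_mulVec, dotProduct_smul, smul_eq_mul,
    Complex.re_ofReal_mul]
  have h := (posSemidef_sum_numberOp_mul_numberOp (Λ := FermionTorus 2 L)).re_dotProduct_nonneg ψ
  have h' : 0 ≤ (star ψ ⬝ᵥ (∑ x : FermionTorus 2 L, numberOp x 0 * numberOp x 1) *ᵥ ψ).re := by simpa using h
  nlinarith [sub_nonneg.2 hU]

/-- **… and move by at most `(U' − U)L²` on unit vectors.** -/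
theorem re_rayleigh_seededCan_le_add_U (L : ℕ) [NeZero L] {U U' : ℝ} (hU : U ≤ U') (g : ℝ)
    {ψ : Fock (Orb (FermionTorus 2 L))} (hψ : star ψ ⬝ᵥ ψ = 1) :
    (star ψ ⬝ᵥ (hubbardTorus 2 L 1 U' - ((g / (L : ℝ) ^ 2 : ℝ) : ℂ) •
        ((pairField dWaveFormFactor L)ᴴ * pairField dWaveFormFactor L)) *ᵥ ψ).re ≤
      (star ψ ⬝ᵥ (hubbardTorus 2 L 1 U - ((g / (L : ℝ) ^ 2 : ℝ) : ℂ) •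
        ((pairField dWaveFormFactor L)ᴴ * pairField dWaveFormFactor L)) *ᵥ ψ).re + (U' - U) * (L : ℝ) ^ 2 := by
  have hdecomp := seededCan_sub_seededCan_U L U U' g
  rw [sub_eq_iff_eq_add] at hdecomp
  rw [hdecomp, add_mulVec, dotProduct_add, Complex.add_re, smul_mulVec, dotProduct_smul, smul_eq_mul,
    Complex.re_ofReal_mul]
  have h := (re_rayleigh_interaction_mem_Icc L hψ).2
  nlinarith [sub_nonneg.2 hU]

/-- **Sector energies of the seeded canonical Hamiltonian are non-decreasing in `U`** (`K ≠ ⊥`). -/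
theorem minEnergyOn_seededCan_mono_U (L : ℕ) [NeZero L] {U U' : ℝ} (hU : U ≤ U') (g : ℝ)
    (K : Submodule ℂ (Fock (Orb (FermionTorus 2 L)))) (hK : K ≠ ⊥) :
    (hubbardTorus 2 L 1 U - ((g / (L : ℝ) ^ 2 : ℝ) : ℂ) •
        ((pairField dWaveFormFactor L)ᴴ * pairField dWaveFormFactor L)).minEnergyOn K ≤
      (hubbardTorus 2 L 1 U' - ((g / (L : ℝ) ^ 2 : ℝ) : ℂ) •
        ((pairField dWaveFormFactor L)ᴴ * pairField dWaveFormFactor L)).minEnergyOn K := by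
  obtain ⟨v, hvK, hv0⟩ := (Submodule.ne_bot_iff K).1 hK
  obtain ⟨c, -, hc1⟩ := exists_smul_unit hv0
  refine le_csInf ⟨_, c • v, K.smul_mem c hvK, hc1, rfl⟩ ?_
  rintro E ⟨φ, hφK, hφ1, rfl⟩
  exact (minEnergyOn_le_rayleigh_of_mem (isHermitian_seededCan L U g) K hφK hφ1).trans
    (re_rayleigh_seededCan_mono_U L hU g φ)

/-- **… and move by at most `(U' − U)L²`.** -/
theorem minEnergyOn_seededCan_le_add_U (L : ℕ) [NeZero L] {U U' : ℝ} (hU : U ≤ U') (g : ℝ)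
    (K : Submodule ℂ (Fock (Orb (FermionTorus 2 L)))) (hK : K ≠ ⊥) :
    (hubbardTorus 2 L 1 U' - ((g / (L : ℝ) ^ 2 : ℝ) : ℂ) •
        ((pairField dWaveFormFactor L)ᴴ * pairField dWaveFormFactor L)).minEnergyOn K ≤
      (hubbardTorus 2 L 1 U - ((g / (L : ℝ) ^ 2 : ℝ) : ℂ) •
        ((pairField dWaveFormFactor L)ᴴ * pairField dWaveFormFactor L)).minEnergyOn K + (U' - U) * (L : ℝ) ^ 2 := by
  obtain ⟨v, hvK, hv0⟩ := (Submodule.ne_bot_iff K).1 hK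
  obtain ⟨c, -, hc1⟩ := exists_smul_unit hv0
  rw [← sub_le_iff_le_add]
  refine le_csInf ⟨_, c • v, K.smul_mem c hvK, hc1, rfl⟩ ?_
  rintro E ⟨φ, hφK, hφ1, rfl⟩
  have h1 := minEnergyOn_le_rayleigh_of_mem (isHermitian_seededCan L U' g) K hφK hφ1
  have h2 := re_rayleigh_seededCan_le_add_U L hU g hφ1
  linarith

/-! ### The grand-canonical ground energy -/

/-- **The grand-canonical seeded ground energy is non-decreasing in `U`.** -/
theorem groundEnergy_seededGC_mono_U (L : ℕ) [NeZero L] {U U' : ℝ} (hU : U ≤ U') (μ g : ℝ) :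
    (hubbardTorusWith 2 L 1 U μ - ((g / (L : ℝ) ^ 2 : ℝ) : ℂ) •
        ((pairField dWaveFormFactor L)ᴴ * pairField dWaveFormFactor L)).groundEnergy ≤
      (hubbardTorusWith 2 L 1 U' μ - ((g / (L : ℝ) ^ 2 : ℝ) : ℂ) •
        ((pairField dWaveFormFactor L)ᴴ * pairField dWaveFormFactor L)).groundEnergy := by
  refine groundEnergy_mono_of_posSemidef_sub (isHermitian_seededGC L U μ g) (isHermitian_seededGC L U' μ g) ?_
  rw [seededGC_sub_seededGC_U]
  exact (posSemidef_sum_numberOp_mul_numberOp (Λ := FermionTorus 2 L)).smul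
    (Complex.zero_le_real.2 (sub_nonneg.2 hU))

/-- **… and moves by at most `(U' − U)L²`** (the ground state at `U` is a trial state at `U'`). -/
theorem groundEnergy_seededGC_le_add_U (L : ℕ) [NeZero L] {U U' : ℝ} (hU : U ≤ U') (μ g : ℝ) :
    (hubbardTorusWith 2 L 1 U' μ - ((g / (L : ℝ) ^ 2 : ℝ) : ℂ) •
        ((pairField dWaveFormFactor L)ᴴ * pairField dWaveFormFactor L)).groundEnergy ≤
      (hubbardTorusWith 2 L 1 U μ - ((g / (L : ℝ) ^ 2 : ℝ) : ℂ) •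
        ((pairField dWaveFormFactor L)ᴴ * pairField dWaveFormFactor L)).groundEnergy + (U' - U) * (L : ℝ) ^ 2 := by
  obtain ⟨ψ, hψ1, hray⟩ := Matrix.exists_groundState_unit (isHermitian_seededGC L U μ g)
  have htrial := groundEnergy_le_rayleigh_holds (isHermitian_seededGC L U' μ g) ψ hψ1
  have hdecomp := (sub_eq_iff_eq_add'.1 (seededGC_sub_seededGC_U L U U' μ g))
  have hsplit : (star ψ ⬝ᵥ (hubbardTorusWith 2 L 1 U' μ - ((g / (L : ℝ) ^ 2 : ℝ) : ℂ) •
      ((pairField dWaveFormFactor L)ᴴ * pairField dWaveFormFactor L)) *ᵥ ψ).re =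
      (hubbardTorusWith 2 L 1 U μ - ((g / (L : ℝ) ^ 2 : ℝ) : ℂ) •
        ((pairField dWaveFormFactor L)ᴴ * pairField dWaveFormFactor L)).groundEnergy +
        (U' - U) * (star ψ ⬝ᵥ (∑ x : FermionTorus 2 L, numberOp x 0 * numberOp x 1) *ᵥ ψ).re := by
    rw [hdecomp, add_mulVec, dotProduct_add, Complex.add_re, hray, smul_mulVec, dotProduct_smul, smul_eq_mul,
      Complex.re_ofReal_mul]
  rw [hsplit] at htrial
  have h := (re_rayleigh_interaction_mem_Icc L hψ1).2
  nlinarith [sub_nonneg.2 hU]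

/-! ### Template F — coupling transfer of the T = 0 hull gap -/

/-- **Template F (coupling transfer of the hull gap).** For `U ≤ U'`, every `μ, ν, g` and every sector
`K ≠ ⊥`: `Gap(U') ≤ Gap(U) + (U' − U)L²`, `Gap(U) := minE(Hcan(U,g), K) − ν − E₀(Hgc(U,μ,g))`. -/
theorem hullGap_coupling_transfer (L : ℕ) [NeZero L] {U U' : ℝ} (hU : U ≤ U') (μ ν g : ℝ)
    (K : Submodule ℂ (Fock (Orb (FermionTorus 2 L)))) (hK : K ≠ ⊥) :
    (hubbardTorus 2 L 1 U' - ((g / (L : ℝ) ^ 2 : ℝ) : ℂ) •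
        ((pairField dWaveFormFactor L)ᴴ * pairField dWaveFormFactor L)).minEnergyOn K - ν -
      (hubbardTorusWith 2 L 1 U' μ - ((g / (L : ℝ) ^ 2 : ℝ) : ℂ) •
        ((pairField dWaveFormFactor L)ᴴ * pairField dWaveFormFactor L)).groundEnergy ≤
      ((hubbardTorus 2 L 1 U - ((g / (L : ℝ) ^ 2 : ℝ) : ℂ) •
        ((pairField dWaveFormFactor L)ᴴ * pairField dWaveFormFactor L)).minEnergyOn K - ν -
      (hubbardTorusWith 2 L 1 U μ - ((g / (L : ℝ) ^ 2 : ℝ) : ℂ) •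
        ((pairField dWaveFormFactor L)ᴴ * pairField dWaveFormFactor L)).groundEnergy) + (U' - U) * (L : ℝ) ^ 2 := by
  have h1 := minEnergyOn_seededCan_le_add_U L hU g K hK
  have h2 := groundEnergy_seededGC_mono_U L hU μ g
  linarith

/-- **Template F, reverse direction**: `Gap(U) ≤ Gap(U') + (U' − U)L²`; together, `|Gap(U') − Gap(U)| ≤ (U' − U)L²`:
the T = 0 hull gap per site is `1`-Lipschitz in the repulsion. -/
theorem hullGap_coupling_transfer' (L : ℕ) [NeZero L] {U U' : ℝ} (hU : U ≤ U') (μ ν g : ℝ)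
    (K : Submodule ℂ (Fock (Orb (FermionTorus 2 L)))) (hK : K ≠ ⊥) :
    (hubbardTorus 2 L 1 U - ((g / (L : ℝ) ^ 2 : ℝ) : ℂ) •
        ((pairField dWaveFormFactor L)ᴴ * pairField dWaveFormFactor L)).minEnergyOn K - ν -
      (hubbardTorusWith 2 L 1 U μ - ((g / (L : ℝ) ^ 2 : ℝ) : ℂ) •
        ((pairField dWaveFormFactor L)ᴴ * pairField dWaveFormFactor L)).groundEnergy ≤
      ((hubbardTorus 2 L 1 U' - ((g / (L : ℝ) ^ 2 : ℝ) : ℂ) •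
        ((pairField dWaveFormFactor L)ᴴ * pairField dWaveFormFactor L)).minEnergyOn K - ν -
      (hubbardTorusWith 2 L 1 U' μ - ((g / (L : ℝ) ^ 2 : ℝ) : ℂ) •
        ((pairField dWaveFormFactor L)ᴴ * pairField dWaveFormFactor L)).groundEnergy) + (U' - U) * (L : ℝ) ^ 2 := by
  have h1 := minEnergyOn_seededCan_mono_U L hU g K hK
  have h2 := groundEnergy_seededGC_le_add_U L hU μ g
  linarith

end

end Summit.HubbardSuperconductivity.HubbardSuperconductivity.Theorems.TwSeededEnsembleEquivalence.Negative
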